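import Summits.HodgeConjecture.CorCM.HypLiu418.A3Liu418GSCentralDecomposition
import Literature.NumberTheory.Automorphic.Liu2021.AppendixC.OmegaHomFactorSlice
import HarnessLib

/-!
# The per-label factorisation at the GS face and the index of occurring central characters of `ℚ_ℓ^{ac} ⊗ H¹_ét(Sh⋆)`

Summit `HodgeConjecture`, sub-problem `CorCM`, crux `HLiu418`, line `a3_liu418` (GS-6, see-saw decomposition at the face);
namespace `Summit.HodgeConjecture.CorCM.Lines.A3Liu418`.  Sequel of `A3Liu418GSCentralDecomposition` (the weight projections
`weightProj ρZ hfix ψ` inside the Hom-space, `psiTilde`, `chiOfWeight`, `isAutomorphicOneChar_psiTilde`) over the generic Literature leaf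
`Liu2021/AppendixC/OmegaHomFactorSlice` (`EtaleHeckeDatum.exists_factor_slice_mem_omegaHom`).  Three `def`s with body (`OccWeight`,
`occProj`, `occChi` — the index of occurring characters, its projections, its `Chi`-labels) and THEOREMS; no named fact, no instance,
no `sorry`.

* §1 **`exists_factor_slice_mem_omegaHom_GS`** — for every occurring central character `ψ` and every
  `f′ ∈ Hom_{U(J⋆)(𝔸_f)}(ι′∘ρ, ℚ_ℓ^{ac} ⊗ H¹_ét)`, `p_ψ ∘ f′ = g ∘ q` with `q := (e ⊗ 1) ∘ q_{ψ̃} ∘ Φ` and every slice of `g` in the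
  Hom-space of `ρ′` — the generic factorisation with ALL `H¹`-side inputs discharged at `X := etaleHeckeDatumGS`,
  `zc := finAdelicCenter`, `c := 1`, `P := weightProj ρZ hfix ψ`, `ψ′ := ψ̃`; the source-side data `(ρ₁, ρ₂, χ, ρV, ρ, Φ, ρ′, e)` and
  their four hypotheses (the face identification, the at-line identification, the commutation `hc`, the common-centre clause `hzc`)
  stay generic;
* §2 **`OccWeight`** (the characters `ψ` of `E¹(𝔸_{F⁺,f})` with `weightProj ρZ hfix ψ ≠ 0`), **`occProj`** / `occProj_apply`,
  **`eq_zero_of_forall_occProj_eq_zero`** (joint injectivity: a vector killed by every occurring projection is `0`),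
  `occProj_baseChange_towerRep` (Galois commutation), `occProj_baseChange_rhoEt` (Hecke commutation), **`occChi`** / `occChi_val`
  (`χc i := chiOfWeight i.1 _`, an automorphic `Chi`).
This is the `(I, P, inj, comm, χc)` head of the see-saw decomposition of `H¹_ét(Sh⋆) ⊗ ℚ_ℓ^{ac}` at the face in the proof of
[Liu2021] Thm. 4.15 (l. 2199–2212).  HC_CM is not mentioned by this file.

## References
* [Liu2021] Y. Liu, Camb. J. Math. 9 (2021): proof of Thm. 4.15 (FJcycle.tex l. 2199–2212; print pp. 50–51), §4.2 (l. 2158–2165;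
  print pp. 49–50), Def. 4.11 (l. 2090), App. D §D.1 Step 3 (l. 5221).
* [GelbartRogawski1991] S. Gelbart, J. Rogawski, Invent. Math. 105 (1991), §3.1 pp. 454–457.
-/

set_option autoImplicit false

noncomputable section

/-! ## §1. The per-label factorisation at the GS face: `OmegaHomFactorSlice.exists_factor_slice_mem_omegaHom` with all `H¹`-side
inputs discharged (`X := etaleHeckeDatumGS`, `zc := finAdelicCenter`, `c := 1`, `P := weightProj ρZ hfix ψ`, `ψ′ := ψ̃`); the source-side data
`(ρ₁, ρ₂, χ, ρV, ρ, Φ, ρ′, e)` and their four hypotheses stay generic. -/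

namespace Summit.HodgeConjecture.CorCM.Lines.A3Liu418

open CategoryTheory NumberField IsDedekindDomain
open scoped TensorProduct Classical
open Literature.AlgebraicGeometry.Motives
open Literature.AlgebraicGeometry.ShimuraVarieties.UnitaryCanonicalModel
open Literature.NumberTheory.Automorphic Literature.NumberTheory.Automorphic.UnitaryGroup
open Literature.NumberTheory.Automorphic.Liu2021 Literature.NumberTheory.Automorphic.Liu2021.AppendixC
open Summit.HodgeConjecture.CorCM.Model Summit.HodgeConjecture.CorCM.Model.HComp
open Literature.RepresentationTheory Literature.RepresentationTheory.TwistedCoinv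

section FaceFac

variable {F : CMField} {ι₁ : F →+* ℂ} {Jstar : Matrix (Fin 2) (Fin 2) F}
  {K₀ : C5.OpenCompactSubgroup ↥(finAdelic (↥(maximalRealSubfield F)) F (IsCMField.complexConj F) 2 Jstar)}
  (S : RecordSystemGS F Jstar ι₁ K₀)
  (hU7ₛ : S.HeckeTranslateDefinedOver) (hLQ : S.IsLevelQuotient) (h4 : 4 ≤ Module.finrank ℚ F) (isoₛ : ℕ → Prop)
  (ℓ : ℕ) [Fact ℓ.Prime] (ι' : ℂ ≃+* AlgebraicClosure ℚ_[ℓ])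
  {S₁ S₂ W W₁ : Type} [AddCommGroup S₁] [Module ℂ S₁] [AddCommGroup S₂] [Module ℂ S₂] [AddCommGroup W] [Module ℂ W]
  [AddCommGroup W₁] [Module ℂ W₁]
  (ρ₁ : Representation ℂ ↥(finAdelicOne (↥(maximalRealSubfield (F : Type))) (F : Type) (IsCMField.complexConj (F : Type))) S₁)
  (ρ₂ : Representation ℂ ↥(finAdelicOne (↥(maximalRealSubfield (F : Type))) (F : Type) (IsCMField.complexConj (F : Type))) S₂)
  (χ : ↥(finAdelicOne (↥(maximalRealSubfield (F : Type))) (F : Type) (IsCMField.complexConj (F : Type))) →* ℂˣ)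
  (ρV : Representation ℂ ↥(finAdelic (↥(maximalRealSubfield F)) F (IsCMField.complexConj F) 2 Jstar) S₁)
  (ρ : Representation ℂ ↥(finAdelic (↥(maximalRealSubfield F)) F (IsCMField.complexConj F) 2 Jstar) W)
  (Φ : W ≃ₗ[ℂ] Coinv (ρ₁.tprod ρ₂) χ)
  (ρ' : Representation ℂ ↥(finAdelic (↥(maximalRealSubfield F)) F (IsCMField.complexConj F) 2 Jstar) W₁)
  (ψ : ↥(finAdelicOne (↥(maximalRealSubfield (F : Type))) (F : Type) (IsCMField.complexConj (F : Type))) →* (AlgebraicClosure ℚ_[ℓ])ˣ)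
  (e : Coinv ρ₁ (psiTilde ℓ ι' ψ) ≃ₗ[ℂ] W₁)

/-- **The per-label factorisation AT THE GS FACE (per occurring `ψ`)**: for every `f′ ∈ Hom_{U(J⋆)(𝔸_f)}(ι′∘ρ, ℚ_ℓ^{ac} ⊗ H¹_ét)`, `p_ψ ∘ f′ = g ∘ q` with
`q := (e ⊗ 1) ∘ q_{ψ̃} ∘ Φ : W → W₁ ⊗ Coinv ρ₂ (χ·ψ̃⁻¹)` and every slice `x ↦ g (x ⊗ m)` in `Hom(ι′∘ρ′, ℚ_ℓ^{ac} ⊗ H¹_ét)` — the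
`(M i, q i, g)` tail of `DecompositionAtFace` at the label `ψ̃ = ι′⁻¹∘ψ`, given (f1-adapted) `Φ, hΦ`, (f1′) `e, he`, the dual-pair
commutation `hc` and the common-centre clause `hzc` (★ `finPairRepV_finAdelicCenter`).  `H¹` side: (f3a)/(f3c) via `weightProj_baseChange_rhoEt` / `rhoEt_finAdelicCenter_baseChange_weightProj`.
[cite: Liu2021, proof of Thm. 4.15 (FJcycle.tex l. 2199–2212); App. D §D.1 Step 3 (l. 5221)] -/
theorem exists_factor_slice_mem_omegaHom_GS
    (hc : ∀ (g : ↥(finAdelic (↥(maximalRealSubfield F)) F (IsCMField.complexConj F) 2 Jstar))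
      (h : ↥(finAdelicOne (↥(maximalRealSubfield (F : Type))) (F : Type) (IsCMField.complexConj (F : Type)))), Commute (ρV g) (ρ₁ h))
    (hzc : ∀ (z : ↥(finAdelicOne (↥(maximalRealSubfield (F : Type))) (F : Type) (IsCMField.complexConj (F : Type)))) (v : S₁),
      ρV (finAdelicCenter (↥(maximalRealSubfield (F : Type))) (F : Type) (IsCMField.complexConj (F : Type)) 2 Jstar z) v = ρ₁ z v)
    (hΦ : ∀ (g : ↥(finAdelic (↥(maximalRealSubfield F)) F (IsCMField.complexConj F) 2 Jstar)) (w : W),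
      Φ (ρ g w) = rep χ (ρV.tprod (1 : Representation ℂ _ S₂)) (commute_tprod_one ρ₁ ρ₂ ρV hc) g (Φ w))
    (he : ∀ (g : ↥(finAdelic (↥(maximalRealSubfield F)) F (IsCMField.complexConj F) 2 Jstar)) (x : Coinv ρ₁ (psiTilde ℓ ι' ψ)),
      e (rep (psiTilde ℓ ι' ψ) ρV hc g x) = ρ' g (e x))
    {f' : W →ₛₗ[(ι' : ℂ →+* AlgebraicClosure ℚ_[ℓ])] AlgebraicClosure ℚ_[ℓ] ⊗[ℚ_[ℓ]] (sec42DataGS S h4 isoₛ).etaleH1Tower ℓ}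
    (hf' : f' ∈ (etaleHeckeDatumGS S hU7ₛ hLQ h4 isoₛ ℓ).omegaHom ι' ρ) :
    ∃ g : W₁ ⊗[ℂ] Coinv ρ₂ (χ * (psiTilde ℓ ι' ψ)⁻¹) →ₛₗ[(ι' : ℂ →+* AlgebraicClosure ℚ_[ℓ])]
        AlgebraicClosure ℚ_[ℓ] ⊗[ℚ_[ℓ]] (sec42DataGS S h4 isoₛ).etaleH1Tower ℓ,
      (∀ w : W, weightProj (rhoEtCenterGSExt S hU7ₛ hLQ h4 isoₛ ℓ (AlgebraicClosure ℚ_[ℓ]))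
          (exists_finiteIndex_forall_rhoEtCenterGSExt_eq S hU7ₛ hLQ h4 isoₛ ℓ (AlgebraicClosure ℚ_[ℓ])) ψ (f' w) =
        g (TensorProduct.congr e (LinearEquiv.refl ℂ (Coinv ρ₂ (χ * (psiTilde ℓ ι' ψ)⁻¹)))
          (coinvTprodQuot ρ₁ ρ₂ χ (psiTilde ℓ ι' ψ) (Φ w)))) ∧
      ∀ m : Coinv ρ₂ (χ * (psiTilde ℓ ι' ψ)⁻¹),
        g.comp ((TensorProduct.mk ℂ W₁ (Coinv ρ₂ (χ * (psiTilde ℓ ι' ψ)⁻¹))).flip m) ∈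
          (etaleHeckeDatumGS S hU7ₛ hLQ h4 isoₛ ℓ).omegaHom ι' ρ' :=
  (etaleHeckeDatumGS S hU7ₛ hLQ h4 isoₛ ℓ).exists_factor_slice_mem_omegaHom ι' ρ₁ ρ₂ χ (psiTilde ℓ ι' ψ) ρV
    (finAdelicCenter (↥(maximalRealSubfield (F : Type))) (F : Type) (IsCMField.complexConj (F : Type)) 2 Jstar) 1 ρ Φ ρ' e
    (weightProj (rhoEtCenterGSExt S hU7ₛ hLQ h4 isoₛ ℓ (AlgebraicClosure ℚ_[ℓ]))
      (exists_finiteIndex_forall_rhoEtCenterGSExt_eq S hU7ₛ hLQ h4 isoₛ ℓ (AlgebraicClosure ℚ_[ℓ])) ψ)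
    hc (fun z v => (hzc z v).trans (one_smul ℂ _).symm) hΦ he
    (weightProj_baseChange_rhoEt S hU7ₛ hLQ h4 isoₛ ℓ ψ) (rhoEt_finAdelicCenter_baseChange_weightProj S hU7ₛ hLQ h4 isoₛ ℓ ι' ψ) hf'

end FaceFac

end Summit.HodgeConjecture.CorCM.Lines.A3Liu418

/-! ## §2. The index of occurring central characters: `(I, P, joint injectivity, Galois commutation, χc)` -/

namespace Summit.HodgeConjecture.CorCM.Lines.A3Liu418

open CategoryTheory NumberField IsDedekindDomain
open scoped TensorProduct Classical
open Literature.AlgebraicGeometry.Motives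
open Literature.AlgebraicGeometry.ShimuraVarieties.UnitaryCanonicalModel
open Literature.NumberTheory.Automorphic Literature.NumberTheory.Automorphic.UnitaryGroup
open Literature.NumberTheory.Automorphic.Liu2021 Literature.NumberTheory.Automorphic.Liu2021.AppendixC
open Summit.HodgeConjecture.CorCM.Model Summit.HodgeConjecture.CorCM.Model.HComp
open Literature.RepresentationTheory Literature.RepresentationTheory.TwistedCoinv

section Index

variable {F : CMField} {ι₁ : F →+* ℂ} {Jstar : Matrix (Fin 2) (Fin 2) F}
  {K₀ : C5.OpenCompactSubgroup ↥(finAdelic (↥(maximalRealSubfield F)) F (IsCMField.complexConj F) 2 Jstar)}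
  (S : RecordSystemGS F Jstar ι₁ K₀)
  (hU7ₛ : S.HeckeTranslateDefinedOver) (hLQ : S.IsLevelQuotient) (h4 : 4 ≤ Module.finrank ℚ F) (isoₛ : ℕ → Prop)
  (ℓ : ℕ) [Fact ℓ.Prime] (ι' : ℂ ≃+* AlgebraicClosure ℚ_[ℓ])

/-- **`I` — the OCCURRING central characters**: those `ψ : E¹(𝔸_{F⁺,f}) →* (ℚ_ℓ^{ac})ˣ` whose weight projection `p_ψ` is non-zero on
`ℚ_ℓ^{ac} ⊗ H¹_ét`. [cite: Liu2021, proof of Thm. 4.15 (FJcycle.tex l. 2199–2212)] -/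
def OccWeight : Type :=
  {ψ : ↥(finAdelicOne (↥(maximalRealSubfield (F : Type))) (F : Type) (IsCMField.complexConj (F : Type))) →* (AlgebraicClosure ℚ_[ℓ])ˣ //
    ∃ v : AlgebraicClosure ℚ_[ℓ] ⊗[ℚ_[ℓ]] (sec42DataGS S h4 isoₛ).etaleH1Tower ℓ,
      weightProj (rhoEtCenterGSExt S hU7ₛ hLQ h4 isoₛ ℓ (AlgebraicClosure ℚ_[ℓ]))
        (exists_finiteIndex_forall_rhoEtCenterGSExt_eq S hU7ₛ hLQ h4 isoₛ ℓ (AlgebraicClosure ℚ_[ℓ])) ψ v ≠ 0}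

/-- **`P i := p_{i.1}`**. [cite: Liu2021, proof of Thm. 4.15 (FJcycle.tex l. 2199–2212)] -/
def occProj (i : OccWeight S hU7ₛ hLQ h4 isoₛ ℓ) :
    AlgebraicClosure ℚ_[ℓ] ⊗[ℚ_[ℓ]] (sec42DataGS S h4 isoₛ).etaleH1Tower ℓ →ₗ[AlgebraicClosure ℚ_[ℓ]]
      AlgebraicClosure ℚ_[ℓ] ⊗[ℚ_[ℓ]] (sec42DataGS S h4 isoₛ).etaleH1Tower ℓ :=
  weightProj (rhoEtCenterGSExt S hU7ₛ hLQ h4 isoₛ ℓ (AlgebraicClosure ℚ_[ℓ]))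
    (exists_finiteIndex_forall_rhoEtCenterGSExt_eq S hU7ₛ hLQ h4 isoₛ ℓ (AlgebraicClosure ℚ_[ℓ])) i.1

/-- unfolding (`rfl`). [cite: Liu2021, proof of Thm. 4.15 (FJcycle.tex l. 2199–2212)] -/
theorem occProj_apply (i : OccWeight S hU7ₛ hLQ h4 isoₛ ℓ) (x : AlgebraicClosure ℚ_[ℓ] ⊗[ℚ_[ℓ]] (sec42DataGS S h4 isoₛ).etaleH1Tower ℓ) :
    occProj S hU7ₛ hLQ h4 isoₛ ℓ i x =
      weightProj (rhoEtCenterGSExt S hU7ₛ hLQ h4 isoₛ ℓ (AlgebraicClosure ℚ_[ℓ]))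
        (exists_finiteIndex_forall_rhoEtCenterGSExt_eq S hU7ₛ hLQ h4 isoₛ ℓ (AlgebraicClosure ℚ_[ℓ])) i.1 x := rfl

/-- **JOINT INJECTIVITY of the occurring projections** (package clause `(∀ i, P i x = 0) → x = 0`): `x = ∑_ψ p_ψ x` over a finite set
(`exists_finset_sum_weightProj`), and a non-zero summand is an occurring label. [cite: Liu2021, proof of Thm. 4.15 (FJcycle.tex l. 2199–2212)] -/
theorem eq_zero_of_forall_occProj_eq_zero (x : AlgebraicClosure ℚ_[ℓ] ⊗[ℚ_[ℓ]] (sec42DataGS S h4 isoₛ).etaleH1Tower ℓ)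
    (hx : ∀ i : OccWeight S hU7ₛ hLQ h4 isoₛ ℓ, occProj S hU7ₛ hLQ h4 isoₛ ℓ i x = 0) : x = 0 := by
  obtain ⟨s, -, hs⟩ := exists_finset_sum_weightProj (rhoEtCenterGSExt S hU7ₛ hLQ h4 isoₛ ℓ (AlgebraicClosure ℚ_[ℓ]))
    (exists_finiteIndex_forall_rhoEtCenterGSExt_eq S hU7ₛ hLQ h4 isoₛ ℓ (AlgebraicClosure ℚ_[ℓ])) x
  rw [← hs]
  refine Finset.sum_eq_zero fun ψ _ => ?_
  by_contra hψ
  exact hψ (hx ⟨ψ, x, hψ⟩)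

/-- **the occurring projections commute with the Galois action** (package clause; (f3b)). [cite: Liu2021, §4.2 (FJcycle.tex l. 2160; print pp. 49–50)] -/
theorem occProj_baseChange_towerRep (i : OccWeight S hU7ₛ hLQ h4 isoₛ ℓ) (σ : Field.absoluteGaloisGroup (F : Type))
    (x : AlgebraicClosure ℚ_[ℓ] ⊗[ℚ_[ℓ]] (sec42DataGS S h4 isoₛ).etaleH1Tower ℓ) :
    occProj S hU7ₛ hLQ h4 isoₛ ℓ i (((sec42DataGS S h4 isoₛ).towerRep ℓ σ).baseChange (AlgebraicClosure ℚ_[ℓ]) x) =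
      ((sec42DataGS S h4 isoₛ).towerRep ℓ σ).baseChange (AlgebraicClosure ℚ_[ℓ]) (occProj S hU7ₛ hLQ h4 isoₛ ℓ i x) :=
  weightProj_baseChange_towerRep S hU7ₛ hLQ h4 isoₛ ℓ σ i.1 x

/-- **the occurring projections commute with the Hecke operators** ((f3a); feeds `hPT`). [cite: Liu2021, §4.2 (FJcycle.tex l. 2160; print pp. 49–50)] -/
theorem occProj_baseChange_rhoEt (i : OccWeight S hU7ₛ hLQ h4 isoₛ ℓ)
    (g : ↥(finAdelic (↥(maximalRealSubfield F)) F (IsCMField.complexConj F) 2 Jstar))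
    (x : AlgebraicClosure ℚ_[ℓ] ⊗[ℚ_[ℓ]] (sec42DataGS S h4 isoₛ).etaleH1Tower ℓ) :
    occProj S hU7ₛ hLQ h4 isoₛ ℓ i ((((etaleHeckeDatumGS S hU7ₛ hLQ h4 isoₛ ℓ).rhoEt g).baseChange (AlgebraicClosure ℚ_[ℓ])) x) =
      (((etaleHeckeDatumGS S hU7ₛ hLQ h4 isoₛ ℓ).rhoEt g).baseChange (AlgebraicClosure ℚ_[ℓ])) (occProj S hU7ₛ hLQ h4 isoₛ ℓ i x) :=
  weightProj_baseChange_rhoEt S hU7ₛ hLQ h4 isoₛ ℓ i.1 g x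

/-- **`χc i` — the automorphic label of an occurring character** (`⟨ι′⁻¹ ∘ i.1, _⟩ : Chi`). [cite: Liu2021, Def. 4.11 (l. 2090)] -/
def occChi (i : OccWeight S hU7ₛ hLQ h4 isoₛ ℓ) :
    Def411WeilCarriers.Chi (↥(maximalRealSubfield (F : Type))) (F : Type) (IsCMField.complexConj (F : Type)) :=
  chiOfWeight S hU7ₛ hLQ h4 isoₛ ℓ ι' i.1 i.2.choose_spec

/-- `(occChi i).1 = ψ̃ = ι′⁻¹ ∘ i.1` (`rfl`). [cite: Liu2021, Def. 4.11 (l. 2090)] -/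
theorem occChi_val (i : OccWeight S hU7ₛ hLQ h4 isoₛ ℓ) : (occChi S hU7ₛ hLQ h4 isoₛ ℓ ι' i).1 = psiTilde ℓ ι' i.1 := rfl

end Index

end Summit.HodgeConjecture.CorCM.Lines.A3Liu418

end
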